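import Summits.ValiantsHypothesis.ValiantsHypothesis.Theses.FeketeSOS
import Literature.NumberTheory.LFunctions.FeketePolynomial

/-!
# Line `hyperoctahedral-support-rigidity` for crux `FeketeSOS.FeketeNoSparseSplit` (stmt-ValiantsHypothesis-3997)

Skeleton (crux-plan, planner-cruxplan-stmt-ValiantsHypothesis-3997-hyperoctahedral-supp-0, 2026-08-16) of crux
idea card `Cruxes/FeketeNoSparseSplit/Ideas/hyperoctahedral-support-rigidity.md` (crux-ideate r1, ideator 2;
triage r1-2 **fail** "as a line for THIS crux — dominated by line 1, mechanism NOT broken", r1-3 **pass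
(conditional line; do not race it against line 1)**, merge ≈ `galois-orbit-density`), with the r1-3 sharpening and
this seat's re-derivation of the terminal check built in.

THE CRUX (route `FeketeSOS`, rank 4): `∃ δ > 0, ∃ p₀, ∀ primes p ≥ p₀, ∀ A B : ℂ[X], A·B = F_p →
p^{1/2+δ} ≤ |supp A| + |supp B|`, `F_p = Σ_{m<p} (m|p) X^m` the Fekete polynomial.

STATUS OF THIS LINE.  It is the CONDITIONAL, STRONG-FORM line of the crux: it reaches the TRUE ORDER of the
phenomenon — every splitting of `F_p` whose two factors both have at least five terms has support-sum `≥ p − 1`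
(`DenseFactors`, the card's `C⁺`; tight: the family `x^ε (1 − x²)·R_F`, `p ≡ 1 (mod 4)`) — but only under ONE
open arithmetic input, `stub_galoisTypeTransitive` (the Galois group of `F_p` permutes the non-trivial zeros
type-transitively; a consequence of Mináč–Nguyen–Tân's Conjecture 4.13 `Gal(f_p/ℚ) = (ℤ/2)^h ⋊ S_h`,
arXiv:2111.05256, verified by them for `7 ≤ p < 632`, irreducibility for `p < 10⁴`).  The crux item itself is
closed unconditionally (bound `(p+3)/2`) by the registered line `Lines/cyclic-valuation-dichotomy.lean`; this
file records the Galois mechanism as a checked skeleton so that (i) its five PROVABLE stubs can be closed by idle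
provers, leaving exactly the conjecture open, and (ii) the route keeps a kernel-checked statement of "the `s = 2`
rung of FeketeSOS is not a threshold phenomenon: non-peel splittings are dense".

THE LINE (six registered stubs, then a kernel-checked composition):
* `stub_halfDescent` (M⁻, elementary, provable now): the HALF-SWAP DESCENT in closed form.  Blocks `i : ι` carry
  two distinct "halves" `a i ≠ b i`; if `c · Π_{i∈S} (X − half_e(i))` has vanishing `j`-th coefficient for EVERY
  set `S` of `s ≤ |ι|` blocks and EVERY choice `e` of halves, then `c` has `s + 1` consecutive vanishing
  coefficients `c_{j−s}, …, c_j` (difference trick `(X−α)P − (X−α')P = (α'−α)P` plus `[X^j]((X−α)P) = P_{j−1} − αP_j`).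
* `stub_blockDescent` (M⁻, elementary, provable now): the BLOCK-SWAP DESCENT in closed form (the card's
  `BlockProductRigidity`): with distinct traces `t i`, if `c · Π_{i∈F}(X² − t_i X + 1)` has vanishing `j`-th
  coefficient for every `f`-set `F` of blocks, `f < |ι|`, then `[X^{j−a}]((X²+1)^{f−a} c) = 0` for all `a ≤ f`
  (`(X²−tX+1)Q − (X²−t'X+1)Q = (t'−t)·X·Q`, and `Q_{j−2} + Q_j = t Q_{j−1} = 0`).
* `stub_trivialZeros` (M/L, TRUE — Conrey–Granville–Poonen–Soundararajan 2000 §1 = Mináč–Nguyen–Tân Prop 2.1): the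
  trivial zeros of `F_p` over `ℂ` have EXACT multiplicities `ord₀ = 1`, `ord₁ = 1, ord₋₁ = 0` (`p ≡ 3 mod 4`),
  `ord₁ = 2, ord₋₁ = 1` (`p ≡ 1 mod 4`) — generalized Bernoulli numbers `B_{1,χ_p} = −h(−p) ≠ 0`, `B_{2,χ_p} ≠ 0`
  and Berndt's class-number sums (`L(1,χ_p) ≠ 0`, `L(2,χ_p) ≠ 0` underneath).  This is hypothesis (H2) of the card:
  it pins the finite list of rational cofactors `c ∣ (X−1)²(X+1)` the terminal check runs over.
* `stub_galoisTypeTransitive` (OPEN CONJECTURE — the load-bearing arithmetic input; hardest): for all large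
  primes `p`, the non-trivial zeros `Z_p = {z : F_p(z) = 0, z ∉ {0, ±1}}` are simple and for any two finite
  `T, T' ⊆ Z_p` of the same TYPE (same size, same number of elements whose inverse is also in the set) some
  `ℚ`-embedding `φ : ℚ(Z_p) → ℂ` maps `T` onto `T'` (`ℚ(Z_p)` is the splitting field of `F_p`, so these are the
  Galois automorphisms).  Implied by MNT Conjecture 4.13 (`Gal = W_h` is transitive on every type class) and
  already by the weaker "`Gal(g_p) ⊇ A_h` on blocks + the inertia `(h/2)`-cycle + `s_p` non-square" (triage r1-3
  sharpening, which closes the transversal type); verified range `7 ≤ p < 632` (MNT Prop 4.8, Prop 4.14 + tables).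
* `stub_zeroCoeffTransport` (M, provable now — Galois plumbing): type-transitivity ⇒ a vanishing coefficient of
  `c · Π_{z∈T}(X − z)`, `c ∈ ℚ[X]`, is shared by `c · Π_{z∈T'}(X − z)` for every `T'` of the same type (apply `φ`
  coefficientwise; `φ(T) = T'` by injectivity and `|T| = |T'|`).
* `stub_denseOfRigidity` (M⁺/L⁻, provable now GIVEN the two descents as hypotheses): factor shape
  `A = u·X^ε·c_A·Π_{z∈T}(X − z)` (`c_A ∣ (X−1)²(X+1)` by `stub_trivialZeros`, `T ⊆ Z_p` a set by simplicity),
  transport of a hole to the whole type class, the two descents, and the TERMINAL CHECK (this seat's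
  re-derivation, simpler than the card's): the hole position `j` is killed by the constant coefficient when
  `j ≤ f+s`, by the leading coefficient when `j ≥ f+s+deg c_A`, and otherwise by an interior coefficient of `c_A`
  itself (`(X−1)² ↦ −2`, `(X−1)²(X+1) ↦ −1, −1`) — the unique survivor is `c_A = X² − 1`, `s = 0`, `j = f + 1`
  (the centre of the anti-palindrome `(X²−1)·R_F`), whose cofactor `c_B = X − 1` has no survivor; hence at most
  ONE hole in total and support-sum `≥ (p − 2) + 2 − 1 = p − 1` whenever both factors have ≥ 5 terms (a factor
  with ≤ 4 terms is exactly a "peel" `u X^ε c`, `c ∣ (X−1)²(X+1)`).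
* `denseFactors_eventually` (PROVED here from the six stubs) and `FeketeNoSparseSplit_of` (PROVED here: the
  TRANSFER `C⁺ ⇒` crux with `δ = 1/4`, `p₀ = max(p_Galois, 256)`: if a factor has `≤ 4` terms the other has
  `≥ (p−1)/4` by `card_support_mul_le`, so `4(|supp A| + |supp B|) ≥ p + 3` in all cases, and `p^{3/4} ≤ p/4`
  because `p^{1/4} ≥ 4`).

Disproof.lean (cdisprove cycles 1–2, read 2026-08-16; landed `Theorems/FeketeNoSparseSplit/Negative/`
{FalseWithoutLegendre p75430, SmallModels p74401, StubHypotheses p76705, ExponentHalf p76840, ModTwoShadow p77033}):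
(i) `feketeNoSparseSplit_false_without_legendre` — HONOURED: the line uses the VALUES of `χ_p` at
`stub_trivialZeros` (class-number / Bernoulli non-vanishing decides the multiplicities at `±1`) and at
`stub_galoisTypeTransitive` (the Galois group of THIS polynomial); for the digit-tiling witnesses of §A the
"trivial part" is huge and the terminal check is void.  (ii) §B `not_trivialSplittingOptimal`, `peel_split`,
`peel_split_one_mod_four`, `not_eventuallyTrivialOptimal` — RESPECTED: `DenseFactors` quantifies only over
splittings with BOTH factors of `≥ 5` terms (peels excluded) and claims `p − 1`, not `p`.  (iii)
`feketeNoSparseSplit_false_at_delta_half` — RESPECTED: `δ = 1/4`.  (iv) §A2/§C (place over 2; composite moduli) —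
not in contact: nothing is reduced anywhere; primality enters through `stub_trivialZeros`/the Galois stub.  (v) §D
concerns line 1's stubs only; no `-- Targets` entry names this line.  No stub is an instance of a landed Negative
lemma (checked against all five files) nor of the summit's negatives index (UlrichPadded 5668, ElusiveElusiveCandidate
0340, GrenetRigidity 3735/3738 — unrelated).
-/

namespace Summit.ValiantsHypothesis.ValiantsHypothesis.Cruxes.FeketeNoSparseSplit.HyperoctahedralSupportRigidity

open Polynomial
open Summit.ValiantsHypothesis.ValiantsHypothesis.Theses
open Literature.NumberTheory.LFunctions

set_option linter.unusedVariables false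
set_option linter.dupNamespace false

/-! ## Vocabulary -/

/-- The complex Fekete polynomial `F_p = Σ_{m<p} (m|p) X^m ∈ ℂ[X]` (the tree's `feketePolynomial p` pushed to `ℂ`;
`FC_eq`: it is LITERALLY the right-hand side of the crux). -/
noncomputable def FC (p : ℕ) [Fact p.Prime] : ℂ[X] :=
  (feketePolynomial p).map (Int.castRingHom ℂ)

/-- `FC p` unfolds to the crux's inlined sum. -/
theorem FC_eq (p : ℕ) [Fact p.Prime] :
    FC p = ∑ m ∈ Finset.range p, C ((legendreSym p m : ℤ) : ℂ) * X ^ m :=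
  map_feketePolynomial_complex p

/-- The NON-TRIVIAL zeros of `F_p` in `ℂ`: zeros other than `0, 1, −1` (the zeros of MNT's `f_p`). -/
def Z (p : ℕ) [Fact p.Prime] : Set ℂ :=
  {z | (FC p).IsRoot z ∧ z ≠ 0 ∧ z ≠ 1 ∧ z ≠ -1}

open scoped Classical in
/-- The number of elements of `T` whose inverse also lies in `T` (= twice the number of FULL reciprocal blocks
`{α, α⁻¹} ⊆ T`).  Two subsets of `Z_p` have the same TYPE `(f, s)` iff they have the same cardinality `2f + s` and
the same `pairedCard = 2f`. -/
noncomputable def pairedCard (T : Finset ℂ) : ℕ :=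
  (T.filter fun z => z⁻¹ ∈ T).card

/-- `ℚ(Z_p) ⊆ ℂ`, the field generated by the non-trivial zeros — the splitting field of `F_p` inside `ℂ`
(`0, ±1 ∈ ℚ`), so its `ℚ`-embeddings into `ℂ` are exactly the Galois automorphisms. -/
noncomputable def KZ (p : ℕ) [Fact p.Prime] : IntermediateField ℚ ℂ :=
  IntermediateField.adjoin ℚ (Z p)

theorem mem_KZ {p : ℕ} [Fact p.Prime] {z : ℂ} (hz : z ∈ Z p) : z ∈ KZ p :=
  IntermediateField.subset_adjoin ℚ (Z p) hz

/-- **Type-transitivity of the Galois action on the non-trivial zeros** (at the prime `p`): any two finite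
`T, T' ⊆ Z_p` of the same type are matched by a `ℚ`-embedding `ℚ(Z_p) → ℂ` (`φ(T) = T'`; as `φ` permutes `Z_p`,
the condition below says exactly that).  Holds whenever `Gal(F_p/ℚ)` is the full hyperoctahedral group
`W_h = (ℤ/2)^h ⋊ S_h` of the `h` blocks `{α, α⁻¹}` (MNT Conjecture 4.13; known for `7 ≤ p < 632`), and already for
its index-`2` subgroups containing an odd flip (triage r1-3). -/
def TypeTransitive (p : ℕ) [Fact p.Prime] : Prop :=
  ∀ T T' : Finset ℂ, (↑T : Set ℂ) ⊆ Z p → (↑T' : Set ℂ) ⊆ Z p → T.card = T'.card →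
    pairedCard T = pairedCard T' →
      ∃ φ : KZ p →ₐ[ℚ] ℂ, ∀ (z : ℂ) (hz : z ∈ Z p), (φ ⟨z, mem_KZ hz⟩ ∈ T' ↔ z ∈ T)

/-- **Simplicity of the non-trivial zeros** (at `p`): every `z ∈ Z_p` is a simple zero of `F_p` (⇐ irreducibility
of `f_p`, MNT Remark 4.15, verified for `p < 10⁴`; conjectural in general). -/
def NontrivialZerosSimple (p : ℕ) [Fact p.Prime] : Prop :=
  ∀ z ∈ Z p, (FC p).rootMultiplicity z = 1

/-- **Exact trivial zeros** (at `p`): `ord₀ F_p = 1`; `ord₁ F_p = 2`, `ord₋₁ F_p = 1` if `p ≡ 1 (mod 4)`, and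
`ord₁ F_p = 1`, `ord₋₁ F_p = 0` otherwise (CGPS 2000 §1; MNT Prop 2.1).  So the rational part of `F_p` is
`X(X−1)` resp. `X(X−1)²(X+1)` and `F_p = u · X · c_tot · Π_{z ∈ Z_p} (X − z)^{ord_z}`. -/
def TrivialZeros (p : ℕ) [Fact p.Prime] : Prop :=
  (FC p).rootMultiplicity 0 = 1 ∧
    (FC p).rootMultiplicity 1 = (if p % 4 = 1 then 2 else 1) ∧
      (FC p).rootMultiplicity (-1) = (if p % 4 = 1 then 1 else 0)

/-- **Zero-coefficient transport along a type class** (at `p`): for `T, T' ⊆ Z_p` of the same type and any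
rational cofactor `c`, a vanishing coefficient of `c · Π_{z∈T}(X − z)` is also a vanishing coefficient of
`c · Π_{z∈T'}(X − z)`.  (The output of the Galois input that the descent consumes.) -/
def ZeroCoeffTransport (p : ℕ) [Fact p.Prime] : Prop :=
  ∀ T T' : Finset ℂ, (↑T : Set ℂ) ⊆ Z p → (↑T' : Set ℂ) ⊆ Z p → T.card = T'.card →
    pairedCard T = pairedCard T' →
      ∀ (c : ℚ[X]) (j : ℕ), (c.map (algebraMap ℚ ℂ) * ∏ z ∈ T, (X - C z)).coeff j = 0 →
        (c.map (algebraMap ℚ ℂ) * ∏ z ∈ T', (X - C z)).coeff j = 0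

/-- The statement of `stub_halfDescent` as a named proposition (hypothesis of `stub_denseOfRigidity`). -/
def HalfDescent : Prop :=
  ∀ (K : Type) [Field K] (ι : Type) [Fintype ι] [DecidableEq ι] (a b : ι → K), (∀ i, a i ≠ b i) →
    ∀ (c : K[X]) (s j : ℕ), s ≤ Fintype.card ι →
      (∀ (S : Finset ι) (e : ι → Bool), S.card = s →
        (c * ∏ i ∈ S, (X - C (if e i then a i else b i))).coeff j = 0) →
      ∀ u : ℕ, u ≤ s → u ≤ j → c.coeff (j - u) = 0

/-- The statement of `stub_blockDescent` as a named proposition (hypothesis of `stub_denseOfRigidity`). -/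
def BlockDescent : Prop :=
  ∀ (K : Type) [Field K] (ι : Type) [Fintype ι] [DecidableEq ι] (t : ι → K), Function.Injective t →
    ∀ (c : K[X]) (f j : ℕ), f < Fintype.card ι →
      (∀ F : Finset ι, F.card = f → (c * ∏ i ∈ F, (X ^ 2 - C (t i) * X + 1)).coeff j = 0) →
      ∀ a : ℕ, a ≤ f → a ≤ j → ((X ^ 2 + 1) ^ (f - a) * c).coeff (j - a) = 0

/-- **`C⁺` at the prime `p` — dense factors.**  Every splitting `A·B = F_p` over `ℂ` in which BOTH factors have
at least five terms (equivalently, given `TrivialZeros p`: both factors have a non-trivial zero — no "peel") has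
support-sum `≥ p − 1`.  Tight for `p ≡ 1 (mod 4)` (the family `x^ε (1 − x²)·R_F`, `F` a proper non-empty block
union: exactly one hole, at the centre), `= p` for all other non-peel splittings; exhaustively confirmed for
`p = 7, 11, 13, 17, 19, 23` (card: kit j011562; triage r1-2: comp/split_classify_pure.py; item evidence p = 29). -/
def DenseFactors (p : ℕ) [Fact p.Prime] : Prop :=
  ∀ A B : ℂ[X], A * B = FC p → 5 ≤ A.support.card → 5 ≤ B.support.card →
    p - 1 ≤ A.support.card + B.support.card

/-! ## The six registered stubs -/

/-- **Stub 1 — half-swap descent (elementary; M⁻).**  Index type `ι` = reciprocal blocks, `a i ≠ b i` the two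
halves of block `i` (in the application `b i = (a i)⁻¹`).  If for EVERY `s`-set `S` of blocks (`s ≤ |ι|`) and
EVERY choice `e` of one half per block the polynomial `c · Π_{i∈S} (X − half)` has vanishing `j`-th coefficient,
then `c_{j−u} = 0` for all `u ≤ s` (with `u ≤ j`).
Why plausibly true (proof): induction on `s`, for all `c, j` simultaneously.  `s = 0`: `S = ∅` gives `c_j = 0`.
`s + 1 ≤ |ι|`: for an `s`-set `S'` and halves `e'` pick a block `i ∉ S'`; the two extensions by `a i` and by `b i`
both vanish at `j`, so `(b i − a i)·[X^j](c·P_{S',e'}) = 0`, i.e. `[X^j](c P_{S',e'}) = 0`, and then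
`[X^j]((X − a i)·cP) = (cP)_{j−1} − a i·(cP)_j` gives `[X^{j−1}](c P_{S',e'}) = 0` (`coeff_X_sub_C_mul`-type
bookkeeping, `Polynomial.coeff_mul_X_sub_C`); apply the induction hypothesis at `j` and at `j − 1`.  Only
`a i ≠ b i` is used (no distinctness across blocks).  Sanity: `s = |ι| = 1`, `c = X − a − b`… any explicit case
checks by hand; the statement is the card's `SubsetProductRigidity` re-cut to the block structure the application
actually has (the card's version over ALL `k`-subsets of a set does not apply to half-type families). -/
theorem stub_halfDescent :
    ∀ (K : Type) [Field K] (ι : Type) [Fintype ι] [DecidableEq ι] (a b : ι → K), (∀ i, a i ≠ b i) →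
      ∀ (c : K[X]) (s j : ℕ), s ≤ Fintype.card ι →
        (∀ (S : Finset ι) (e : ι → Bool), S.card = s →
          (c * ∏ i ∈ S, (X - C (if e i then a i else b i))).coeff j = 0) →
        ∀ u : ℕ, u ≤ s → u ≤ j → c.coeff (j - u) = 0 := by
  sorry

/-- **Stub 2 — block-swap descent (elementary; M⁻; the card's `BlockProductRigidity` verbatim).**  With pairwise
distinct traces `t i` (`t i = α_i + α_i⁻¹`), if `c · Π_{i∈F} (X² − t_i X + 1)` has vanishing `j`-th coefficient for
every `f`-set `F` of blocks with `f < |ι|` (a free block exists), then `[X^{j−a}]((X²+1)^{f−a}·c) = 0` for every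
`a ≤ f`, `a ≤ j`.
Why plausibly true (proof): induction on `f` for all `c, j`.  `f = 0`: `F = ∅`, `a = 0`.  Step: for an `f`-set
`F'` pick two further blocks `i ≠ i'` (possible as `f + 1 < |ι|`); subtracting the two vanishing coefficients
gives `(t i' − t i)·[X^j](X·c·R_{F'}) = 0`, so `[X^{j−1}](c R_{F'}) = 0` (for `j ≥ 1`), and then
`[X^j]((X² − t_i X + 1)·Q) = Q_{j−2} − t_i Q_{j−1} + Q_j = 0` gives `[X^j]((X²+1)·c·R_{F'}) = 0`; so the
hypothesis holds for `(f, c, j−1)` and for `(f, (X²+1)c, j)`, and the two induction hypotheses cover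
`a ∈ [1, f+1]` and `a ∈ [0, f]`.  Injectivity of `t` is essential (equal traces make the difference vanish). -/
theorem stub_blockDescent :
    ∀ (K : Type) [Field K] (ι : Type) [Fintype ι] [DecidableEq ι] (t : ι → K), Function.Injective t →
      ∀ (c : K[X]) (f j : ℕ), f < Fintype.card ι →
        (∀ F : Finset ι, F.card = f → (c * ∏ i ∈ F, (X ^ 2 - C (t i) * X + 1)).coeff j = 0) →
        ∀ a : ℕ, a ≤ f → a ≤ j → ((X ^ 2 + 1) ^ (f - a) * c).coeff (j - a) = 0 := by
  sorry

/-- **Stub 3 — exact trivial zeros of `F_p` (TRUE; Conrey–Granville–Poonen–Soundararajan, Ann. Inst. Fourier 50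
(2000) §1; Mináč–Nguyen–Tân, J. Number Theory 2023 = arXiv:2111.05256, Prop 2.1 with Lemmas 2.2, 2.3, 2.5; M/L).**
For an odd prime `p`: `ord₀ F_p = 1`, and `ord₁ F_p = 2, ord₋₁ F_p = 1` if `p ≡ 1 (mod 4)`, `ord₁ F_p = 1,
ord₋₁ F_p = 0` if `p ≡ 3 (mod 4)`.
Why true: `ord₀ = 1` since `F_p(0) = 0`, `F_p'(0) = (1|p) = 1`.  `F_p(1) = Σ χ_p = 0`; `F_p'(1) = Σ_m m χ_p(m)
= p·B_{1,χ_p}`, which is `0` for `p ≡ 1 (4)` (symmetry `m ↔ p − m`) and `= −p·h(−p) ≠ 0` for `p ≡ 3 (4)`, `p > 3`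
(Dirichlet's class number formula; `p = 3`: `Σ mχ = −1`); for `p ≡ 1 (4)`, `F_p''(1) = Σ m²χ_p(m) = p·B_{2,χ_p} ≠ 0`
(`L(2, χ_p) ≠ 0`).  `F_p(−1) = 2(2(2|p) − 1)·h(−p) ≠ 0` for `p ≡ 3 (4)` (Berndt), `= 0` for `p ≡ 1 (4)` with
`F_p'(−1) = 4(2|p)·Σ_{m<p/2} m χ_p(m) ≠ 0` (Berndt).  Lean route: `Polynomial.rootMultiplicity_eq_natTrailingDegree`
/ `taylor`, derivative evaluations as character sums (`eval_one_feketePolynomial`, `eval_neg_one_feketePolynomial`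
in tree), and the non-vanishing either via Mathlib's Dirichlet `L`-function values
(`DirichletCharacter.LFunction` at `s = 1`, functional equation) or as named Literature facts
("`Σ_{m<p} m χ_p(m) = −p h(−p)`", Berndt's half-sum formulas) used as cite hypotheses.  Checked numerically by the
card's and triage's enumerations (the trivial part is exactly `x(1−x)` / `x(1−x)²(1+x)` for all `p ≤ 29` tested)
and it is what MNT divide by to DEFINE `f_p` for every `p`. -/
theorem stub_trivialZeros :
    ∀ (p : ℕ) [Fact p.Prime], p ≠ 2 → TrivialZeros p := by
  sorry

/-- **Stub 4 — the Galois input (OPEN CONJECTURE; hardest; the single load-bearing arithmetic hypothesis of the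
line).**  For all large primes `p`: the non-trivial zeros of `F_p` are simple, and the `ℚ`-embeddings
`ℚ(Z_p) → ℂ` act TYPE-TRANSITIVELY on finite subsets of `Z_p` (see `TypeTransitive`).
Status: implied by Mináč–Nguyen–Tân, arXiv:2111.05256, Conjecture 4.13 (`Gal(ℚ(f_p)/ℚ) = (ℤ/2)^{h_p} ⋊ S_{h_p}`,
`h_p = deg g_p`; the full hyperoctahedral group is transitive on every type class `(f, s)`), which they verify for
`p ≤ 43` by `[ℚ(f_p):ℚ] = 2^h·h!` (Prop 4.8) and for all `7 ≤ p < 632` by Frobenius cycle-type quadruples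
(Prop 4.14 + tables); irreducibility (hence simplicity) verified for `p < 10⁴` (Remark 4.15: "we do not have a
precise explanation").  By triage r1-3 the weaker input "`Gal(g_p) ⊇ A_h` on blocks" already suffices: the flip
kernel contains the inertia element `τ^{h/2}` (Newton polygon of `g_p(2+z)` at `p` is one segment of height `1`
because `g_p(2) = p·h(−p)` with `0 < h(−p) < p`, `p ≡ 3 (4)`), hence all even flips, and `Δ(f_p) = s_p Δ(g_p)²`
with `s_p` never a rational square (MNT Lemma 4.1, Prop 4.4) supplies an odd flip — each of the three possible
groups is type-transitive, transversal type included.  NOBODY can prove this for all `p` today (already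
"`g_p` irreducible for all `p`" is open); random-reciprocal-polynomial heuristics (Davis–Duke–Sun, cited by MNT)
make it overwhelmingly plausible.  For `p ≤ 5`, `Z_p = ∅` and the statement is trivially true.  A prover should
NOT spend cycles here; the honest outcome for this stub is `blocked-on`/conjecture. -/
theorem stub_galoisTypeTransitive :
    ∃ p₀ : ℕ, ∀ (p : ℕ) [Fact p.Prime], p₀ ≤ p → NontrivialZerosSimple p ∧ TypeTransitive p := by
  sorry

/-- **Stub 5 — zero-coefficient transport from type-transitivity (Galois plumbing; M; provable now).**
Why true (proof): given `T, T'` of the same type and `φ : ℚ(Z_p) →ₐ[ℚ] ℂ` with `φ z ∈ T' ↔ z ∈ T` on `Z_p`: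
`φ` maps zeros of `F_p ∈ ℚ[X]` to zeros and fixes `0, ±1`, so `φ(Z_p) ⊆ Z_p`, `φ` is injective, `φ(T) ⊆ T'` and
`|T| = |T'|` force `φ(T) = T'` (`Finset.eq_of_subset_of_card_le`).  The polynomial `c·Π_{z∈T}(X − z)` has
coefficients in `ℚ(Z_p)` (lift `T` to a `Finset (KZ p)`; `Polynomial.map_prod`, `map_sub`, `map_X`, `map_C`),
and mapping it coefficientwise along `φ` gives `c·Π_{z∈T'}(X − z)`; a coefficient that is `0` in `ℂ` is `0` in
`ℚ(Z_p)` (injectivity of `algebraMap (KZ p) ℂ`) and stays `0` under `φ`.  The hypotheses `pairedCard T =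
pairedCard T'` and `↑T' ⊆ Z p` are carried, not used. -/
theorem stub_zeroCoeffTransport :
    ∀ (p : ℕ) [Fact p.Prime], TypeTransitive p → ZeroCoeffTransport p := by
  sorry

/-- **Stub 6 — dense factors from rigidity (the card's theorem; M⁺/L⁻; provable now, GIVEN the two descents as
hypotheses and the outputs of stubs 3–5 at `p`).**
Why true (proof sketch, every step checked against the exhaustive data for `p ≤ 29`):
(1) FACTOR SHAPE.  Over `ℂ`, `F_p = u₀ · X · c_tot · Π_{z∈Z_p}(X − z)` with `c_tot = X − 1` (`p ≡ 3 (4)`) or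
`(X−1)²(X+1)` (`p ≡ 1 (4)`) by `TrivialZeros p` and simplicity (`IsAlgClosed.splits`, `Splits.eq_prod_roots` /
`C_leadingCoeff_mul_prod_multiset_X_sub_C`, `roots.le_of_dvd`, `count_roots = rootMultiplicity`,
`roots_prod_X_sub_C`); `Z_p` is closed under `z ↦ z⁻¹` without fixed points
(`reflect_feketePolynomial`: `X^p F_p(1/X) = (−1|p)·F_p`; `z ≠ ±1`), so it is a disjoint union of `h` blocks
`{α, α⁻¹}`.  A divisor `A` of `F_p` is `u · X^ε · c_A · Π_{z∈T}(X − z)` with `ε ≤ 1`, monic `c_A ∣ c_tot` (so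
`c_A ∈ {1, X∓1, (X−1)², X²−1, (X−1)²(X+1)}`, a RATIONAL polynomial) and `T ⊆ Z_p`; `|supp A| = |supp (c_A P_T)|`.
If `|supp A| ≥ 5` then `T ≠ ∅` (else `|supp A| ≤ |supp c_A| ≤ 4`); symmetrically `T ≠ Z_p` when `|supp B| ≥ 5`.
(2) HOLES.  Suppose `[X^j](c_A P_T) = 0` with `j ≤ deg (c_A P_T) = deg c_A + 2f + s`, `(f, s)` the type of `T`
(`f` full blocks, `s` half blocks, `f + s ≤ h`, and `f < h` because `T ≠ Z_p`).  By `ZeroCoeffTransport p` the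
same coefficient vanishes for EVERY `T'` of type `(f, s)`.  Fix any `f`-set of blocks `F` and apply `HalfDescent`
to the blocks outside `F` (`ι` = those `h − f ≥ s` blocks, `a = α`, `b = α⁻¹`, `c := c_A·R_F`,
`R_F = Π_{b∈F}(X² − t_b X + 1)`): `[X^{j−u}](c_A R_F) = 0` for all `u ≤ s`.  This holds for every `F`, so
`BlockDescent` (`ι` = all `h` blocks, `t` injective because the zeros are distinct and `≠ ±1`, `f < h`) gives
`[X^{j−u−a}]((X²+1)^{f−a} c_A) = 0` for all `u ≤ s`, `a ≤ f` (`u + a ≤ j`).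
(3) TERMINAL CHECK (six explicit polynomials).  `j ≤ f + s`: choose `u + a = j`: the constant coefficient of
`(X²+1)^{f−a} c_A` is `c_A(0) = ±1 ≠ 0` — contradiction.  `f + s + deg c_A ≤ j (≤ 2f + s + deg c_A)`: `u = s`,
`a = 2f + s + deg c_A − j ∈ [0, f]`: position `j − s − a` is the TOP degree `2(f−a) + deg c_A`, leading coefficient
`1 ≠ 0` — contradiction.  Remaining `f + s < j < f + s + deg c_A` (only if `deg c_A ≥ 2`): `u = s`, `a = f`:
`[X^{j−s−f}] c_A = 0` at an INTERIOR position of `c_A`: `(X−1)² = X² − 2X + 1 ↦ −2 ≠ 0`; `(X−1)²(X+1) =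
X³ − X² − X + 1 ↦ −1 ≠ 0`; `X² − 1 ↦ 0`: the only survivor, with `j = f + s + 1`; if moreover `s ≥ 1`, take
`u = s − 1`, `a = f`: `[X²](X² − 1) = 1 ≠ 0` — contradiction.  SURVIVOR: `c_A = X² − 1`, `s = 0`, `j = f + 1`
(and it is a genuine hole: `(X²−1)R_F` is anti-palindromic of degree `2f + 2`).
(4) COUNT.  Hence a factor `c_A P_T` with `∅ ≠ T ≠ Z_p` has at most one hole, and one only if `c_A = X² − 1`
(forcing `p ≡ 1 (4)`), in which case `c_B = c_tot / c_A = X − 1` has none.  With `deg(c_A P_{T_A}) +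
deg(c_B P_{T_B}) = p − 2`: `|supp A| + |supp B| ≥ (p − 2) + 2 − 1 = p − 1` (`card_support_eq_natDegree_add_one`-type
counting: support `= [0, deg]` minus holes).
Size: the Lean work is (1) (roots/multiplicities bookkeeping in `ℂ[X]`, `UniqueFactorizationMonoid` or
`Polynomial.roots` of a divisor `≤` roots) and wiring the index types of (2); (3)–(4) are finite computations. -/
theorem stub_denseOfRigidity :
    HalfDescent → BlockDescent →
      ∀ (p : ℕ) [Fact p.Prime], TrivialZeros p → NontrivialZerosSimple p → ZeroCoeffTransport p →
        DenseFactors p := by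
  sorry

/-! ## Proved facts (no `sorry`) -/

/-- `F_p ≠ 0` over `ℂ`. -/
theorem FC_ne_zero (p : ℕ) [Fact p.Prime] : FC p ≠ 0 := by
  rw [FC]
  exact (Polynomial.map_ne_zero_iff (Int.castRingHom ℂ).injective_int).2 (feketePolynomial_ne_zero p)

/-- `F_p` has exactly `p − 1` monomials over `ℂ` (support `[1, p−1]`). -/
theorem card_support_FC (p : ℕ) [Fact p.Prime] : (FC p).support.card = p - 1 := by
  rw [FC, support_map_of_injective _ (Int.castRingHom ℂ).injective_int, card_support_feketePolynomial]

/-! ## The composition (kernel-checked, no `sorry` of its own) -/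

/-- **`C⁺` eventually, from the six stubs**: beyond the Galois threshold every splitting of `F_p` with both
factors of `≥ 5` terms has support-sum `≥ p − 1`. -/
theorem denseFactors_eventually :
    ∃ p₀ : ℕ, ∀ (p : ℕ) [Fact p.Prime], p₀ ≤ p → DenseFactors p := by
  obtain ⟨p₀, hgal⟩ := stub_galoisTypeTransitive
  refine ⟨max p₀ 3, ?_⟩
  intro p _ hp
  have hp₀ : p₀ ≤ p := le_of_max_le_left hp
  have hp3 : 3 ≤ p := le_of_max_le_right hp
  have hp2 : p ≠ 2 := by omega
  obtain ⟨hsimple, htrans⟩ := hgal p hp₀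
  exact stub_denseOfRigidity stub_halfDescent stub_blockDescent p (stub_trivialZeros p hp2) hsimple
    (stub_zeroCoeffTransport p htrans)

/-- **The crux from `C⁺`** (`δ = 1/4`, `p₀ = max (Galois threshold) 256`).  Given `A·B = F_p`: if a factor has
`≤ 4` terms, `p − 1 = |supp F_p| ≤ |supp A|·|supp B|` (`card_support_mul_le`) gives the other `≥ (p−1)/4` terms;
otherwise `C⁺` gives `≥ p − 1`; in all cases `4(|supp A| + |supp B|) ≥ p + 3`, and `p^{3/4} ≤ p/4` because
`p^{1/4} ≥ 256^{1/4} = 4`. -/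
theorem FeketeNoSparseSplit_of : FeketeSOS.FeketeNoSparseSplit := by
  obtain ⟨p₀, hdense⟩ := denseFactors_eventually
  refine ⟨1 / 4, by norm_num, max p₀ 256, ?_⟩
  intro p _ hp A B hAB
  have hprime : p.Prime := Fact.out
  have hp₀ : p₀ ≤ p := le_of_max_le_left hp
  have h256 : 256 ≤ p := le_of_max_le_right hp
  have hAB' : A * B = FC p := by rw [FC_eq]; exact hAB
  have hF0 : FC p ≠ 0 := FC_ne_zero p
  have hcardF : (FC p).support.card = p - 1 := card_support_FC p
  have hA0 : A ≠ 0 := by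
    rintro rfl
    exact hF0 (by rw [← hAB', zero_mul])
  have hB0 : B ≠ 0 := by
    rintro rfl
    exact hF0 (by rw [← hAB', mul_zero])
  have hA1 : 0 < A.support.card := Finset.card_pos.2 (Polynomial.support_nonempty.2 hA0)
  have hB1 : 0 < B.support.card := Finset.card_pos.2 (Polynomial.support_nonempty.2 hB0)
  have hmul : p - 1 ≤ A.support.card * B.support.card := by
    rw [← hcardF, ← hAB']
    exact card_support_mul_le
  -- the key natural-number inequality, by cases on whether a factor is a peel
  have hkey : p + 3 ≤ 4 * (A.support.card + B.support.card) := by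
    by_cases hA5 : 5 ≤ A.support.card
    · by_cases hB5 : 5 ≤ B.support.card
      · have hd := hdense p hp₀ A B hAB' hA5 hB5
        omega
      · have hle : A.support.card * B.support.card ≤ A.support.card * 4 :=
          Nat.mul_le_mul_left _ (by omega)
        generalize hm : A.support.card * B.support.card = m at hmul hle
        omega
    · have hle : A.support.card * B.support.card ≤ 4 * B.support.card :=
        Nat.mul_le_mul_right _ (by omega)
      generalize hm : A.support.card * B.support.card = m at hmul hle
      omega
  -- real arithmetic: p^(3/4) ≤ p/4 ≤ (p+3)/4 ≤ |supp A| + |supp B|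
  have hexp : (1 / 2 + 1 / 4 : ℝ) = 3 / 4 := by norm_num
  rw [hexp]
  have hp256 : (256 : ℝ) ≤ p := by exact_mod_cast h256
  have hppos : (0 : ℝ) < p := by linarith
  have hcast : (p : ℝ) + 3 ≤ 4 * ((A.support.card : ℝ) + (B.support.card : ℝ)) := by
    exact_mod_cast hkey
  have hroot : (4 : ℝ) ≤ (p : ℝ) ^ (1 / 4 : ℝ) := by
    have h256r : (256 : ℝ) ^ (1 / 4 : ℝ) = 4 := by
      have h44 : (4 : ℝ) ^ (4 : ℝ) = 256 := by norm_num
      rw [← h44, ← Real.rpow_mul (by norm_num : (0 : ℝ) ≤ 4)]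
      norm_num
    calc (4 : ℝ) = (256 : ℝ) ^ (1 / 4 : ℝ) := h256r.symm
      _ ≤ (p : ℝ) ^ (1 / 4 : ℝ) := Real.rpow_le_rpow (by norm_num) hp256 (by norm_num)
  have hsplit : (p : ℝ) ^ (3 / 4 : ℝ) * (p : ℝ) ^ (1 / 4 : ℝ) = p := by
    rw [← Real.rpow_add hppos]
    norm_num
  have hnn : 0 ≤ (p : ℝ) ^ (3 / 4 : ℝ) := Real.rpow_nonneg hppos.le _
  have hpow : (p : ℝ) ^ (3 / 4 : ℝ) ≤ (p : ℝ) / 4 := by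
    have h := mul_le_mul_of_nonneg_left hroot hnn
    linarith
  linarith

end Summit.ValiantsHypothesis.ValiantsHypothesis.Cruxes.FeketeNoSparseSplit.HyperoctahedralSupportRigidity
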